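import Summits.Parity.GeneralizedHardyLittlewood.Theorems.LeeYangFibresPrimeCellsRelativeChowlaDefs
import Summits.Parity.GeneralizedHardyLittlewood.Theorems.LeeYangFibresAbsoluteUpgradeSinglesDecayDict
import Summits.Parity.GeneralizedHardyLittlewood.Theorems.LeeYangFibresAbsoluteUpgradeSinglesDecayWeights
import Summits.Parity.GeneralizedHardyLittlewood.Theorems.LeeYangFibresAbsoluteUpgradeSinglesDecayThresholds
import Literature.NumberTheory.Sieve.LinearFormsRoughTupleBound
import HarnessLib

/-!
# Route `LeeYangFibres`, crux `PrimeCellsRelative` (stmt-Parity-14112), line `SketchIdeator4`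
# (card `sieve-out-to-chowla`): helper file 2 for the stub `stub_sieveTransfer` — dictionary and thresholds

Book-keeping for the sieve transfer (`SieveTransfer` of the line's vocabulary file), all about a one-dimensional system
`Ψ` at scale `N`, roughness `y = N^{1/u}` and sifting level `z = ⌊y⌋ + 1`:

* `interval_of_convex` — the lattice points of `K ∩ {all ψ_k ≥ 1}` (`K ⊆ [−N, N]` convex) ARE an integer interval
  `[m₁, m₂]` (stated as an equality of finsets) with `#[m₁, m₂] ≤ β_∞(Ψ, K) + 1`;
* `sum_roughTuples_eq_sum_filter` — for ANY weight `g`, the sum of `g(n₀)` over the rough tuples is the sum of `g` over the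
  rough points of that interval;
* `one_div_log_floor_succ_le` — `1/log z ≤ u/log N`; `sieveProduct_floor_succ_le` — `V(z) = ∏_{p<z}(1 − ω_F(p)/p) ≤
  2 ∏_p β_p (u/log N)^t` once `y ≥ L + 4t² + 1`;
* `level_facts` — `⌊z^s⌋ ≤ ⌊N^{2s/u}⌋` and `N^{2s/u} ≤ N^{1/2}` for `u ≥ 4s`;
* `sum_card_rootsMod_le` — `Σ_{d ≤ D sqfree} #{roots of F mod d} ≤ D e^{2B(log log D + 5)}`;
* `eventually_junk_half` — `C_j + C_r N^{1/2}(log N)^{2B} ≤ N/(log N)^{t+1}` eventually.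

(The sibling line's `Theorems/LeeYangFibresAbsoluteUpgradeSinglesDecayPrep.lean` has the `λ(a_i · + b_i)` instances of the
first two items; the general-weight forms are what the signed transfer needs.)

References: Green–Tao 2010, (1.4), (1.6)–(1.7), App. A [GreenTao2010]; Halberstam–Richert 1974, §5.7 [HalberstamRichert1974].
-/

noncomputable section

open Finset Filter Polynomial ArithmeticFunction MeasureTheory
open scoped ArithmeticFunction.omega Classical

namespace Summit.Parity.GeneralizedHardyLittlewood.Cruxes.PrimeCellsRelative.SieveOutToChowla

open Literature.NumberTheory.Sieve
open Summit.Parity.GeneralizedHardyLittlewood.Theorems.AbsoluteUpgrade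
open Summit.Parity.GeneralizedHardyLittlewood.Cruxes.AbsoluteUpgrade.NlcCellsAbsoluteClip (roughTuples)

variable {t : ℕ}

/-! ### The interval of lattice points -/

/-- **The positive lattice points of `K` ARE an interval of length `≤ β_∞ + 1`.** For a convex `K ⊆ [-N, N]` there are
`m₁, m₂` with `{m ∈ [-N, N] : (m) ∈ K, ψ_k(m) ≥ 1 ∀ k} = [m₁, m₂]` (as finsets) and `#[m₁, m₂] ≤ β_∞(Ψ, K) + 1`.
[cite: GreenTao2010, (1.4) and App. A] -/
theorem interval_of_convex (Ψ : Fin t → AffLinForm 1) {N : ℕ} {K : Set (Fin 1 → ℝ)} (hK : Convex ℝ K)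
    (hKN : K ⊆ realBox 1 N) :
    ∃ m₁ m₂ : ℤ, (Finset.Icc (-(N : ℤ)) N).filter (fun m : ℤ => (fun _ : Fin 1 => (m : ℝ)) ∈ K ∧
        ∀ k, 1 ≤ (Ψ k).eval (fun _ => m)) = Finset.Icc m₁ m₂ ∧
      (#(Finset.Icc m₁ m₂) : ℝ) ≤ archFactor Ψ K + 1 := by
  classical
  -- adapted from `Theorems.AbsoluteUpgrade.exists_interval` (sibling line)
  set S : Set ℝ := {r : ℝ | (fun _ : Fin 1 => r) ∈ K ∧ ∀ i, 0 < (Ψ i).realEval (fun _ => r)} with hS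
  have harch : archFactor Ψ K = (volume S).toReal := DimOne.archFactor_eq Ψ K
  have hSconv : Convex ℝ S := by
    have h1 : Convex ℝ {r : ℝ | (fun _ : Fin 1 => r) ∈ K} := DimOne.convex_slice hK
    have h2 : ∀ i, Convex ℝ {r : ℝ | 0 < (Ψ i).realEval (fun _ => r)} := fun i => by
      have : {r : ℝ | 0 < (Ψ i).realEval (fun _ => r)} =
          {r : ℝ | 0 < ((Ψ i).coeff 0 : ℝ) * r + (Ψ i).const} := by
        ext r; simp [DimOne.realEval_eq]
      rw [this]; exact DimOne.convex_setOf_pos _ _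
    have : S = {r : ℝ | (fun _ : Fin 1 => r) ∈ K} ∩ ⋂ i, {r : ℝ | 0 < (Ψ i).realEval (fun _ => r)} := by
      ext r; simp [hS]
    rw [this]
    exact h1.inter (convex_iInter h2)
  have hSN : S ⊆ Set.Icc (-(N : ℝ)) N := by
    intro r hr
    have h := hKN hr.1
    simp only [realBox, Set.mem_Icc, Pi.le_def] at h
    exact ⟨h.1 0, h.2 0⟩
  obtain ⟨m₁, m₂, hI, hvol⟩ := DimOne.exists_filter_eq_Icc (N := N) hSconv.ordConnected hSN
  refine ⟨m₁, m₂, ?_, ?_⟩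
  · rw [← hI]
    refine Finset.filter_congr fun m _ => ?_
    simp only [hS, Set.mem_setOf_eq]
    have hev : ∀ k, (Ψ k).realEval (fun _ : Fin 1 => (m : ℝ)) = (((Ψ k).eval (fun _ => m) : ℤ) : ℝ) :=
      fun k => (Ψ k).realEval_intCast (fun _ => m)
    simp only [hev]
    constructor
    · rintro ⟨hK', hpos⟩
      exact ⟨hK', fun k => by have := hpos k; exact_mod_cast this⟩
    · rintro ⟨hK', hpos⟩
      exact ⟨hK', fun k => by have := hpos k; exact_mod_cast this⟩
  · rw [harch]
    linarith [(abs_le.mp hvol).2]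

/-! ### Sums over the rough tuples -/

/-- **Sums over the rough tuples are sums over the rough points of the interval** (any weight `g`): with
`[m₁, m₂]` the lattice points of `K ∩ {Ψ ≥ 1}` and `N^{1/u} ≥ 2`,
`Σ_{n ∈ roughTuples} g(n₀) = Σ_{m ∈ [m₁,m₂], all ψ_k(m) rough} g(m)`. [folklore] -/
theorem sum_roughTuples_eq_sum_filter (Ψ : Fin t → AffLinForm 1) {N u : ℕ}
    (hN2 : (2 : ℝ) ≤ (N : ℝ) ^ ((1 : ℝ) / u)) (K : Set (Fin 1 → ℝ)) {m₁ m₂ : ℤ}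
    (hI : (Finset.Icc (-(N : ℤ)) N).filter (fun m : ℤ => (fun _ : Fin 1 => (m : ℝ)) ∈ K ∧
        ∀ k, 1 ≤ (Ψ k).eval (fun _ => m)) = Finset.Icc m₁ m₂) (g : ℤ → ℝ) :
    ∑ n ∈ roughTuples Ψ K N u, g (n 0) =
      ∑ m ∈ (Finset.Icc m₁ m₂).filter (fun m : ℤ => ∀ k, (N : ℝ) ^ ((1 : ℝ) / u) <
        (Nat.minFac ((Ψ k).eval (fun _ => m)).toNat : ℝ)), g m := by
  -- adapted from `Theorems.AbsoluteUpgrade.roughTuples_sum_eq` (sibling line)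
  classical
  -- roughness with `N^{1/u} ≥ 2` forces the value to be `≥ 1`
  have hone : ∀ {v : ℤ}, (N : ℝ) ^ ((1 : ℝ) / u) < (Nat.minFac v.toNat : ℝ) → 1 ≤ v := by
    intro v h
    by_contra hv
    push Not at hv
    rw [Int.toNat_of_nonpos (by omega), Nat.minFac_zero] at h
    push_cast at h
    linarith
  unfold roughTuples
  rw [sum_filter_latticeBox, ← hI, Finset.filter_filter]
  refine Finset.sum_congr ?_ fun _ _ => rfl
  refine Finset.filter_congr fun m _ => ?_
  rw [DimOne.realPoint_const]
  constructor
  · rintro ⟨hK', hr⟩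
    exact ⟨⟨hK', fun k => hone (hr k)⟩, hr⟩
  · rintro ⟨⟨hK', -⟩, hr⟩
    exact ⟨hK', hr⟩

/-! ### Numerics of the sifting level `z = ⌊N^{1/u}⌋ + 1` -/

/-- **`1/log z ≤ u/log N`** for `z = ⌊N^{1/u}⌋ + 1` (`u ≥ 1`, `N^{1/u} > 1`). [folklore] -/
theorem one_div_log_floor_succ_le {N u : ℕ} (hu : 1 ≤ u) (hN1 : (1 : ℝ) < (N : ℝ) ^ ((1 : ℝ) / u)) :
    1 / Real.log (((⌊(N : ℝ) ^ ((1 : ℝ) / u)⌋₊ + 1 : ℕ) : ℝ)) ≤ (u : ℝ) / Real.log N := by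
  -- adapted from `Theorems.AbsoluteUpgrade.one_div_log_le` (sibling line)
  set y := (N : ℝ) ^ ((1 : ℝ) / u) with hy
  set z : ℝ := (((⌊y⌋₊ + 1 : ℕ) : ℝ)) with hzdef
  have hyz : y < z := by rw [hzdef]; push_cast; exact Nat.lt_floor_add_one y
  have hu0 : (0 : ℝ) < u := by exact_mod_cast hu
  have hN0 : (0 : ℝ) < N := by
    by_contra h
    push Not at h
    have : (N : ℝ) = 0 := le_antisymm h (Nat.cast_nonneg N)
    rw [this, Real.zero_rpow (by positivity)] at hy
    rw [hy] at hN1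
    linarith
  have hlogy : Real.log y = Real.log N / u := by rw [hy, Real.log_rpow hN0]; ring
  have hlogy0 : 0 < Real.log N / u := by rw [← hlogy]; exact Real.log_pos hN1
  have hlogN : 0 < Real.log N := by
    by_contra h; push Not at h
    have : Real.log N / u ≤ 0 := div_nonpos_of_nonpos_of_nonneg h hu0.le
    linarith
  have hlogz : Real.log N / u ≤ Real.log z := by
    rw [← hlogy]; exact Real.log_le_log (by linarith) hyz.le
  rw [div_le_div_iff₀ (by linarith) hlogN, one_mul]
  calc Real.log N = (Real.log N / u) * u := by field_simp
    _ ≤ Real.log z * u := mul_le_mul_of_nonneg_right hlogz hu0.le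
    _ = u * Real.log z := mul_comm _ _

/-- **The sieve product against the singular product** at `z = ⌊N^{1/u}⌋ + 1`: for a non-degenerate `Ψ` with
`|a_k| ≤ L`, `u ≥ 1` and `N^{1/u} ≥ L + 4t² + 2`,
`V(z) = ∏_{p<z}(1 − ω_F(p)/p) ≤ 2 ∏_p β_p · (u/log N)^t`. [cite: GreenTao2010, (1.6)–(1.7)] -/
theorem sieveProduct_floor_succ_le {Ψ : Fin t → AffLinForm 1} (hΨ : IsNondegenerateSystem Ψ) {L : ℕ}
    (haL : ∀ k, ((Ψ k).coeff 0).natAbs ≤ L) {N u : ℕ} (hu : 1 ≤ u)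
    (hyL : (L : ℝ) + 4 * t ^ 2 + 2 ≤ (N : ℝ) ^ ((1 : ℝ) / u)) :
    ∏ p ∈ Nat.primesBelow ⌈(((⌊(N : ℝ) ^ ((1 : ℝ) / u)⌋₊ + 1 : ℕ) : ℝ))⌉₊,
        (1 - (polyRootCountMod ![sysPoly Ψ] p : ℝ) / p) ≤
      2 * singularProduct Ψ * ((u : ℝ) / Real.log N) ^ t := by
  -- adapted from `Theorems.AbsoluteUpgrade.prod_one_sub_rootCount_le_main` (sibling line)
  set y := (N : ℝ) ^ ((1 : ℝ) / u) with hy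
  have ht0 : (0 : ℝ) ≤ 4 * t ^ 2 := by positivity
  have hL0 : (0 : ℝ) ≤ L := Nat.cast_nonneg L
  have hy1 : 1 < y := by linarith
  have hz1 : (1 : ℝ) < (((⌊y⌋₊ + 1 : ℕ) : ℝ)) := by
    push_cast; linarith [Nat.lt_floor_add_one y]
  have hceil : ⌈(((⌊y⌋₊ + 1 : ℕ) : ℝ))⌉₊ - 1 = ⌊y⌋₊ := by rw [Nat.ceil_natCast, Nat.add_sub_cancel]
  have hhead : L ≤ ⌊y⌋₊ ∧ 4 * t ^ 2 ≤ ⌊y⌋₊ ∧ 1 ≤ ⌊y⌋₊ := by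
    refine ⟨Nat.le_floor ?_, Nat.le_floor ?_, Nat.le_floor ?_⟩
    · linarith
    · push_cast; linarith
    · push_cast; linarith
  have h1 := prod_one_sub_rootCount_le Ψ hz1
  rw [hceil] at h1
  have h2 := singularProductPartial_le_two_mul_singularProduct hΨ haL hhead.1 hhead.2.1 hhead.2.2
  have hW := one_div_log_floor_succ_le hu hy1
  have hlog0 : 0 ≤ 1 / Real.log (((⌊y⌋₊ + 1 : ℕ) : ℝ)) := by
    have := Real.log_pos hz1; positivity
  have hsp0 : 0 ≤ singularProductPartial Ψ ⌊y⌋₊ := Finset.prod_nonneg fun p _ => localFactor_nonneg Ψ p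
  calc _ ≤ singularProductPartial Ψ ⌊y⌋₊ * (1 / Real.log (((⌊y⌋₊ + 1 : ℕ) : ℝ))) ^ t := h1
    _ ≤ (2 * singularProduct Ψ) * ((u : ℝ) / Real.log N) ^ t :=
        mul_le_mul h2 (pow_le_pow_left₀ hlog0 hW t) (pow_nonneg hlog0 t) (by linarith)
    _ = 2 * singularProduct Ψ * ((u : ℝ) / Real.log N) ^ t := by ring

/-- **The sifting level and the moduli**: for `s ≥ 1`, `u ≥ 4s`, `N ≥ 1` and `y = N^{1/u} ≥ 2`, with
`z = ⌊y⌋ + 1 ≤ 2y`: `⌊z^s⌋ ≤ ⌊N^{2s/u}⌋` (`z^s ≤ 2^s y^s ≤ y^{2s} = N^{2s/u}`) and `N^{2s/u} ≤ N^{1/2}`. [folklore] -/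
theorem level_facts {N u : ℕ} {s : ℝ} (hs : 1 ≤ s) (hsu : 4 * s ≤ (u : ℝ)) (hN1 : 1 ≤ (N : ℝ))
    (hy2 : 2 ≤ (N : ℝ) ^ ((1 : ℝ) / u)) :
    ⌊(((⌊(N : ℝ) ^ ((1 : ℝ) / u)⌋₊ + 1 : ℕ) : ℝ)) ^ s⌋₊ ≤ ⌊(N : ℝ) ^ (2 * s / u)⌋₊ ∧
      (N : ℝ) ^ (2 * s / u) ≤ (N : ℝ) ^ ((1 : ℝ) / 2) := by
  set y := (N : ℝ) ^ ((1 : ℝ) / u) with hy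
  have hN0 : (0 : ℝ) < N := by linarith
  have hs0 : 0 ≤ s := by linarith
  have hu0 : (0 : ℝ) < u := by linarith
  have hy0 : 0 ≤ y := by positivity
  have hz : (((⌊y⌋₊ + 1 : ℕ) : ℝ)) ≤ 2 * y := by
    push_cast
    have := Nat.floor_le hy0
    linarith
  have hys : y ^ s = (N : ℝ) ^ (s / u) := by
    rw [hy, ← Real.rpow_mul hN0.le]
    congr 1
    field_simp
  have h2s : (2 : ℝ) ^ s ≤ y ^ s := Real.rpow_le_rpow (by norm_num) hy2 hs0
  constructor
  · refine Nat.floor_mono ?_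
    calc (((⌊y⌋₊ + 1 : ℕ) : ℝ)) ^ s ≤ (2 * y) ^ s := Real.rpow_le_rpow (by positivity) hz hs0
      _ = (2 : ℝ) ^ s * y ^ s := Real.mul_rpow (by norm_num) hy0
      _ ≤ y ^ s * y ^ s := mul_le_mul_of_nonneg_right h2s (Real.rpow_nonneg hy0 s)
      _ = (N : ℝ) ^ (2 * s / u) := by
          rw [hys, ← Real.rpow_add hN0]
          congr 1
          ring
  · refine Real.rpow_le_rpow_of_exponent_le hN1 ?_
    rw [div_le_iff₀ hu0]
    linarith

/-! ### The unit boundary terms and the junk -/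

/-- **The unit boundary terms**: for `F` with `ω_F(p) ≤ B` at every prime and `2 ≤ D`,
`Σ_{d ≤ D sqfree} #{roots of F mod d} ≤ D exp(2B(log log D + 5))`. [cite: HalberstamRichert1974, §5.7] -/
theorem sum_card_rootsMod_le {F : ℤ[X]} {B : ℕ} (hB : ∀ p : ℕ, p.Prime → polyRootCountMod ![F] p ≤ B)
    {D : ℕ} (hD : 2 ≤ D) :
    ∑ d ∈ (Finset.Icc 1 D).filter Squarefree, ((rootsMod F d).card : ℝ) ≤
      D * Real.exp (2 * B * (Real.log (Real.log D) + 5)) := by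
  calc ∑ d ∈ (Finset.Icc 1 D).filter Squarefree, ((rootsMod F d).card : ℝ)
      ≤ ∑ d ∈ (Finset.Icc 1 D).filter Squarefree, (B : ℝ) ^ ω d := by
        refine Finset.sum_le_sum fun d hd => ?_
        rw [card_rootsMod]
        exact rootCount_le_pow_omega hB (Finset.mem_filter.mp hd).2
    _ ≤ ∑ d ∈ Finset.Icc 1 D, (B : ℝ) ^ ω d :=
        Finset.sum_le_sum_of_subset_of_nonneg (Finset.filter_subset _ _) fun d _ _ => by positivity
    _ ≤ D * Real.exp (2 * B * (Real.log (Real.log D) + 5)) := sum_pow_omega_le (Nat.cast_nonneg B) hD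

/-- **Absorbing the junk terms**: eventually `C_j + C_r N^{1/2} (log N)^{2B} ≤ N/(log N)^{t+1}`
(`C_r ≥ 0`). [folklore] -/
theorem eventually_junk_half (t B : ℕ) {Cj Cr : ℝ} (hCr : 0 ≤ Cr) :
    ∀ᶠ N : ℕ in atTop, Cj + Cr * (N : ℝ) ^ ((1 : ℝ) / 2) * Real.log N ^ (2 * B) ≤
      (N : ℝ) / Real.log N ^ (t + 1) := by
  obtain ⟨N₂, hN₂⟩ := RoughTuple.exists_pow_log_le (t + 2)
  obtain ⟨N₃, hN₃⟩ := RoughTuple.exists_pow_log_le (2 * (2 * B + t + 1) + 1)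
  filter_upwards [eventually_ge_atTop N₂, eventually_ge_atTop N₃,
    eventually_log_ge (max 1 (max (2 * Cj) (4 * Cr ^ 2))), eventually_ge_real 1] with N hN2' hN3' hlog hN1
  have hlog1 : 1 ≤ Real.log N := le_trans (le_max_left _ _) hlog
  have hlogj : 2 * Cj ≤ Real.log N := le_trans ((le_max_left _ _).trans (le_max_right _ _)) hlog
  have hlogr : 4 * Cr ^ 2 ≤ Real.log N := le_trans ((le_max_right _ _).trans (le_max_right _ _)) hlog
  have hpow2 := hN₂ N hN2'
  have hpow3 := hN₃ N hN3'
  set Lg := Real.log N with hLg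
  set k : ℕ := 2 * B + t + 1 with hk
  have hL0 : 0 < Lg := by linarith
  have hN0 : (0 : ℝ) < N := by linarith
  have hLt1 : 0 < Lg ^ (t + 1) := pow_pos hL0 _
  -- `Cj Lg^{t+1} ≤ N/2`
  have hj : Cj * Lg ^ (t + 1) ≤ N / 2 := by
    have h1 : 2 * Cj * Lg ^ (t + 1) ≤ Lg * Lg ^ (t + 1) := mul_le_mul_of_nonneg_right hlogj hLt1.le
    have h2 : Lg * Lg ^ (t + 1) = Lg ^ (t + 2) := by ring
    linarith
  -- `Cr N^{1/2} Lg^{2B} Lg^{t+1} = Cr N^{1/2} Lg^k ≤ N/2`: `(2 Cr Lg^k)^2 ≤ Lg^{2k+1} ≤ N`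
  have hsq : (2 * Cr * Lg ^ k) ^ 2 ≤ N := by
    calc (2 * Cr * Lg ^ k) ^ 2 = 4 * Cr ^ 2 * Lg ^ (2 * k) := by ring
      _ ≤ Lg * Lg ^ (2 * k) := mul_le_mul_of_nonneg_right hlogr (pow_nonneg hL0.le _)
      _ = Lg ^ (2 * k + 1) := by ring
      _ ≤ N := hpow3
  have hhalf : 2 * Cr * Lg ^ k ≤ (N : ℝ) ^ ((1 : ℝ) / 2) := by
    have h0 : 0 ≤ 2 * Cr * Lg ^ k := by positivity
    rw [← Real.sqrt_eq_rpow, Real.le_sqrt h0]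
    · exact hsq
    · exact hN0.le
  have hr : Cr * (N : ℝ) ^ ((1 : ℝ) / 2) * Lg ^ (2 * B) * Lg ^ (t + 1) ≤ N / 2 := by
    have hN12 : 0 ≤ (N : ℝ) ^ ((1 : ℝ) / 2) := by positivity
    have e1 : Cr * (N : ℝ) ^ ((1 : ℝ) / 2) * Lg ^ (2 * B) * Lg ^ (t + 1) =
        (Cr * Lg ^ k) * (N : ℝ) ^ ((1 : ℝ) / 2) := by rw [hk]; ring
    have e2 : (N : ℝ) ^ ((1 : ℝ) / 2) * (N : ℝ) ^ ((1 : ℝ) / 2) = N := by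
      rw [← Real.rpow_add hN0]; norm_num
    rw [e1]
    calc Cr * Lg ^ k * (N : ℝ) ^ ((1 : ℝ) / 2)
        ≤ ((N : ℝ) ^ ((1 : ℝ) / 2) / 2) * (N : ℝ) ^ ((1 : ℝ) / 2) := by
          refine mul_le_mul_of_nonneg_right ?_ hN12
          linarith
      _ = N / 2 := by rw [div_mul_eq_mul_div, e2]
  rw [le_div_iff₀ hLt1, add_mul]
  linarith

end Summit.Parity.GeneralizedHardyLittlewood.Cruxes.PrimeCellsRelative.SieveOutToChowla

end
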